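import Literature.Analysis.FluidPDE.TwoHalfNavierStokes
import Literature.Analysis.FluidPDE.PassiveScalarProofs
import Literature.Analysis.FunctionSpaces.TorusAxisAverageCalculus
import Literature.Analysis.FunctionSpaces.TorusWeakFormBookkeeping
import HarnessLib

/-!
# The `2½`-dimensional lift of a planar weak Euler solution and a transported scalar is an
  admissible weak Euler solution on `T³` (Bardos–Titi–Wiedemann 2012, proof of Cor. 2)

Topic `Analysis/FluidPDE` (all proved, plus one definition). Bardos–Titi–Wiedemann, *The vanishing
viscosity as a selection principle for the Euler equations: the case of 3D shear flow*, C. R. Math.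
Acad. Sci. Paris 350 (2012) 757–760, prove their Cor. 2 (non-uniqueness of admissible weak Euler
solutions for vortex-sheet shear data) by the following lift: "Take `u(x,t) = (u₁(x₁,x₂,t),
u₂(x₁,x₂,t))` to be a solution to the 2D vortex sheet problem … Then, the triple
`(u₁(x₁,x₂,t), u₂(x₁,x₂,t), w(x₁,x₂,t))` will be a weak solution of the 3D Euler equations (with
zero pressure and initial data `v₀`) if `w` is a weak solution of the 2D transport equation
`∂ₜw + u·∇w = 0`, `w(t=0) = v₃` … `‖w(·,t)‖_{L²(T²)} ≤ ‖v₃‖_{L²(T²)}` for every `t > 0` … Hence our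
solution `(u₁,u₂,w)` is an admissible weak solution of the 3D Euler equations." This file proves
that statement for arbitrary planar data, in the accepted framework of
`Literature/Analysis/FunctionSpaces/TorusFluidGlue` (`Torus.IsWeakNSSolutionWithDataOn`, weak
Euler = `ν = 0`) and `Literature/Analysis/FluidPDE/PassiveScalar` (`Torus.IsWeakScalarTransportOn`,
DiPerna–Lions weak transport, `κ = 0`):

* `Torus.IsAdmissibleWeakEulerOn T v₀ v` — **definition**: admissible weak Euler solution on
  `T^d × [0,T]` with datum `v₀` (op. cit. §1 (1)–(2); De Lellis–Székelyhidi 2010, Def. 2.3): weak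
  solution with datum, `v ∈ C([0,T];L²_w)`, `v(0) = v₀` a.e., weak energy inequality for every
  `t ∈ [0,T]` — clause for clause the conjuncts of the accepted barrier statement
  `Literature.Barriers.AnomalousDissipation.BardosTitiWiedemann2012_cor2`.
* `Torus.weakIdentity_twoHalf` — the weak Euler identity of `(u, w) ∘ π` against every
  divergence-free space–time test field `ψ` on `T³`: pairing with an `x₃`-independent field only
  sees the `x₃`-average `ψ̄` of `ψ` (`Literature/Analysis/FunctionSpaces/TorusAxisAverageCalculus`),
  `ψ̄ = (Ψ, Ψ₃) ∘ π` with `Ψ` a divergence-free planar test field and `Ψ₃` a scalar test function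
  (`Torus.planarTest`, `Torus.verticalTest`), and the identity splits into the planar Euler
  identity tested with `Ψ` plus the transport identity tested with `Ψ₃`
  (`Literature/Analysis/FunctionSpaces/TorusWeakFormBookkeeping` for the integrability bookkeeping).
* `Torus.isWeaklyDivFree_twoHalf`, `Torus.continuousOn_integral_inner_twoHalf`,
  `Torus.lintegral_enorm_sq_twoHalf_le`, `Torus.twoHalf_zero_ae_eq` — weak incompressibility,
  weak continuity into `L²`, the energy inequality and the initial datum of the lift.
* `Torus.isAdmissibleWeakEulerOn_twoHalf` — **the lift theorem**: for an admissible planar weak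
  Euler solution `u` (datum `v₀ ∈ L²`, `L²` slices) and a weak solution `w` of the transport
  equation driven by `u` (datum `w₀ ∈ L²`, `L²` slices with `‖w(t)‖₂ ≤ ‖w₀‖₂`, weakly continuous,
  `w(0) = w₀`), `(u, w) ∘ π` is an admissible weak Euler solution on `T³ × [0,T]` with datum
  `(v₀, w₀) ∘ π`.

## References

* C. Bardos, E. S. Titi, E. Wiedemann, C. R. Math. Acad. Sci. Paris 350 (2012) 757–760, §1
  (1)–(2), Cor. 2 and its proof (`BardosTitiWiedemann2012`).
* C. De Lellis, L. Székelyhidi Jr., Arch. Ration. Mech. Anal. 195 (2010) 225–260, §2 (1),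
  Def. 2.3 (`DeLellisSzekelyhidi2010`).
* R. J. DiPerna, P.-L. Lions, Invent. Math. 98 (1989) 511–547, §II.1 (`DiPernaLions1989Invent`).
* A. J. Majda, A. L. Bertozzi, *Vorticity and Incompressible Flow* (CUP 2002), §2.3.1
  (two-and-a-half-dimensional flows).
-/

open MeasureTheory Set Filter Topology Function UnitAddTorus
open scoped ENNReal NNReal InnerProductSpace ContDiff
open Literature.Analysis.FunctionSpaces.Torus

noncomputable section

namespace Literature.Analysis.FluidPDE

namespace Torus

/-- The flat three-torus (local notation). [folklore] -/
local notation "𝕋³" => UnitAddTorus (Fin 3)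
/-- The flat two-torus (local notation). [folklore] -/
local notation "𝕋²" => UnitAddTorus (Fin 2)
/-- `ℝ³` (local notation). [folklore] -/
local notation "E³" => EuclideanSpace ℝ (Fin 3)
/-- `ℝ²` (local notation). [folklore] -/
local notation "E²" => EuclideanSpace ℝ (Fin 2)

/-! ## Admissible weak Euler solutions with datum -/

section Admissible

variable {d : Type*} [Fintype d] [DecidableEq d]

/-- **Admissible weak solutions of the Euler equations on `T^d × [0,T]` with initial datum `v₀`**
(Bardos–Titi–Wiedemann 2012, §1, (1)–(2); De Lellis–Székelyhidi 2010, §2 (1) and Def. 2.3, weak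
energy inequality): `v` is a weak (distributional, pressure-free) solution of Euler on
`T^d × [0,T)` with datum `v₀` in the accepted sense `Torus.IsWeakNSSolutionWithDataOn T 0 v₀ v`;
`v ∈ C([0,T]; L²_w(T^d))` — `t ↦ ∫ ⟪v(t), w⟫` is continuous on `[0,T]` for every `w ∈ L²` — with
`v(0) = v₀` a.e.; and `v` satisfies the weak energy inequality
`½∫|v(x,t)|²dx ≤ ½∫|v₀|²dx` for every `t ∈ [0,T]` (as lower Lebesgue integrals of `‖·‖²`).
These are, clause for clause, the four conjuncts of the accepted statement
`Literature.Barriers.AnomalousDissipation.BardosTitiWiedemann2012_cor2`. [cite: BardosTitiWiedemann2012, §1 (1)–(2)] -/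
def IsAdmissibleWeakEulerOn (T : ℝ) (v₀ : UnitAddTorus d → EuclideanSpace ℝ d)
    (v : ℝ → UnitAddTorus d → EuclideanSpace ℝ d) : Prop :=
  FunctionSpaces.Torus.IsWeakNSSolutionWithDataOn T 0 v₀ v ∧
    v 0 =ᵐ[volume] v₀ ∧
    (∀ w : UnitAddTorus d → EuclideanSpace ℝ d, MemLp w 2 volume →
      ContinuousOn (fun t => ∫ x, ⟪v t x, w x⟫_ℝ) (Icc 0 T)) ∧
    ∀ t ∈ Icc 0 T, ∫⁻ x, ‖v t x‖ₑ ^ 2 ≤ ∫⁻ x, ‖v₀ x‖ₑ ^ 2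

omit [DecidableEq d] in
/-- `∫ ‖f‖² = (∫⁻ ‖f‖ₑ²).toReal` for `f ∈ L²`. [folklore] -/
theorem integral_norm_sq_eq_toReal_lintegral {E : Type*} [NormedAddCommGroup E]
    {f : UnitAddTorus d → E} (hf : MemLp f 2 volume) :
    ∫ x, ‖f x‖ ^ 2 = (∫⁻ x, ‖f x‖ₑ ^ 2).toReal := by
  have hint : Integrable (fun x => ‖f x‖ ^ 2) volume := hf.integrable_norm_pow two_ne_zero
  rw [integral_eq_lintegral_of_nonneg_ae (ae_of_all _ fun x => sq_nonneg _) hint.aestronglyMeasurable]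
  congr 1
  refine lintegral_congr fun x => ?_
  rw [← ofReal_norm, ENNReal.ofReal_pow (norm_nonneg _)]

omit [DecidableEq d] in
/-- `∫⁻ ‖f‖ₑ² < ∞` for `f ∈ L²`. [folklore] -/
theorem lintegral_enorm_sq_lt_top {E : Type*} [NormedAddCommGroup E] {f : UnitAddTorus d → E}
    (hf : MemLp f 2 volume) : ∫⁻ x, ‖f x‖ₑ ^ 2 < ⊤ := by
  have h := hf.2
  rw [eLpNorm_lt_top_iff_lintegral_rpow_enorm_lt_top two_ne_zero ENNReal.ofNat_ne_top] at h
  simpa [ENNReal.toReal_ofNat] using h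

omit [DecidableEq d] in
/-- Real form of an `L²` energy bound: `∫⁻ ‖f‖ₑ² ≤ ∫⁻ ‖g‖ₑ²` with `g ∈ L²` gives
`∫ ‖f‖² ≤ (∫⁻ ‖g‖ₑ²).toReal`. [folklore] -/
theorem integral_norm_sq_le_toReal {E : Type*} [NormedAddCommGroup E] {f g : UnitAddTorus d → E}
    (hf : MemLp f 2 volume) (hg : MemLp g 2 volume)
    (h : ∫⁻ x, ‖f x‖ₑ ^ 2 ≤ ∫⁻ x, ‖g x‖ₑ ^ 2) :
    ∫ x, ‖f x‖ ^ 2 ≤ (∫⁻ x, ‖g x‖ₑ ^ 2).toReal := by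
  rw [integral_norm_sq_eq_toReal_lintegral hf]
  exact ENNReal.toReal_mono (lintegral_enorm_sq_lt_top hg).ne h

end Admissible

/-! ## `2½`-dimensional fields: energy, invariance, measurability, the convective identity -/

section TwoHalf

variable {V : 𝕋² → E²} {R : 𝕋² → ℝ}

/-- `‖(V,R)∘π (x)‖ₑ² = ‖V(πx)‖ₑ² + ‖R(πx)‖ₑ²`. [folklore] -/
theorem enorm_sq_twoHalf (V : 𝕋² → E²) (R : 𝕋² → ℝ) (x : 𝕋³) :
    ‖twoHalf V R x‖ₑ ^ 2 = ‖V (planarProj x)‖ₑ ^ 2 + ‖R (planarProj x)‖ₑ ^ 2 := by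
  rw [← ofReal_norm, ← ofReal_norm, ← ofReal_norm, ← ENNReal.ofReal_pow (norm_nonneg _),
    ← ENNReal.ofReal_pow (norm_nonneg _), ← ENNReal.ofReal_pow (norm_nonneg _),
    ← ENNReal.ofReal_add (sq_nonneg _) (sq_nonneg _), norm_sq_twoHalf, Real.norm_eq_abs, sq_abs]

/-- **Energy of `2½`-dimensional fields**: `∫⁻_{T³} ‖(V,R)∘π‖ₑ² = ∫⁻_{T²} ‖V‖ₑ² + ∫⁻_{T²} ‖R‖ₑ²`
(measure preservation of the planar projection). [folklore] -/
theorem lintegral_enorm_sq_twoHalf (hV : AEStronglyMeasurable V volume) (hR : AEStronglyMeasurable R volume) :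
    ∫⁻ x, ‖twoHalf V R x‖ₑ ^ 2 = (∫⁻ y, ‖V y‖ₑ ^ 2) + ∫⁻ y, ‖R y‖ₑ ^ 2 := by
  simp_rw [enorm_sq_twoHalf]
  have hG : AEMeasurable (fun y : 𝕋² => ‖V y‖ₑ ^ 2 + ‖R y‖ₑ ^ 2) volume :=
    (hV.enorm.pow_const 2).add (hR.enorm.pow_const 2)
  have h := lintegral_map' (μ := (volume : Measure 𝕋³)) (f := fun y : 𝕋² => ‖V y‖ₑ ^ 2 + ‖R y‖ₑ ^ 2)
    (g := planarProj) (by rw [measurePreserving_planarProj.map_eq]; exact hG)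
    measurePreserving_planarProj.measurable.aemeasurable
  rw [measurePreserving_planarProj.map_eq] at h
  rw [← h, lintegral_add_left' (hV.enorm.pow_const 2)]

/-- `2½`-dimensional fields are invariant under the translations along the third axis. [folklore] -/
theorem twoHalf_add_single (V : 𝕋² → E²) (R : 𝕋² → ℝ) (s : UnitAddCircle) (x : 𝕋³) :
    twoHalf V R (x + Pi.single (Fin.last 2) s) = twoHalf V R x := by
  rw [twoHalf_eq_comp, Function.comp_apply, Function.comp_apply]
  exact comp_planarProj_add_single (fun y => planarEmbed (V y, R y)) s x

/-- **Joint measurability of time-dependent `2½`-dimensional fields** on `S × T³` from that of the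
planar data on `S × T²` (the map `(t, x) ↦ (t, πx)` preserves the product measures). [folklore] -/
theorem aestronglyMeasurable_uncurry_twoHalf {S : Set ℝ} {u : ℝ → 𝕋² → E²} {w : ℝ → 𝕋² → ℝ}
    (hu : AEStronglyMeasurable (uncurry u) ((volume.restrict S).prod (volume : Measure 𝕋²)))
    (hw : AEStronglyMeasurable (uncurry w) ((volume.restrict S).prod (volume : Measure 𝕋²))) :
    AEStronglyMeasurable (uncurry fun t => twoHalf (u t) (w t))
      ((volume.restrict S).prod (volume : Measure 𝕋³)) := by
  have hΦ : MeasurePreserving (fun p : ℝ × 𝕋³ => (p.1, planarProj p.2))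
      ((volume.restrict S).prod (volume : Measure 𝕋³)) ((volume.restrict S).prod (volume : Measure 𝕋²)) :=
    (MeasurePreserving.id (volume.restrict S)).prod measurePreserving_planarProj
  have h1 := hu.comp_measurePreserving hΦ
  have h2 := hw.comp_measurePreserving hΦ
  have h : uncurry (fun t => twoHalf (u t) (w t)) =
      fun p : ℝ × 𝕋³ => planarEmbed ((uncurry u ∘ fun p : ℝ × 𝕋³ => (p.1, planarProj p.2)) p,
        (uncurry w ∘ fun p : ℝ × 𝕋³ => (p.1, planarProj p.2)) p) := by
    funext p
    rfl
  rw [h]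
  exact planarEmbed.continuous.comp_aestronglyMeasurable (h1.prodMk h2)

/-- **The convective derivative of a `2½`-dimensional field along a `2½`-dimensional field**:
`((V,R)∘π · ∇)((V',R')∘π) = ((V·∇)V', DR'[V]) ∘ π` for `C¹` `V', R'`. [folklore] -/
theorem convect_twoHalf_twoHalf (V : 𝕋² → E²) (R : 𝕋² → ℝ) {V' : 𝕋² → E²} {R' : 𝕋² → ℝ}
    (hV' : IsContDiff 1 V') (hR' : IsContDiff 1 R') :
    FunctionSpaces.Torus.convect (twoHalf V R) (twoHalf V' R') =
      twoHalf (FunctionSpaces.Torus.convect V V') (fun y => FunctionSpaces.Torus.fderiv R' y (V y)) := by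
  funext x
  rw [FunctionSpaces.Torus.convect, twoHalf_eq_comp V' R', fderiv_comp_planarProj (hV'.planarEmbed_pair hR'),
    ContinuousLinearMap.comp_apply]
  have hP : planarProjE (twoHalf V R x) = V (planarProj x) := by
    rw [twoHalf]
    exact planarProjE_planarEmbed _
  rw [hP, fderiv_planarEmbed_pair hV' hR']
  rfl

/-- The convective pairing of `2½`-dimensional fields, pointwise:
`⟪(V,R)∘π, ((V,R)∘π·∇)((V',R')∘π)⟫(x) = ⟪V, (V·∇)V'⟫(πx) + R(πx) DR'(πx)[V(πx)]`. [folklore] -/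
theorem inner_twoHalf_convect (V : 𝕋² → E²) (R : 𝕋² → ℝ) {V' : 𝕋² → E²} {R' : 𝕋² → ℝ}
    (hV' : IsContDiff 1 V') (hR' : IsContDiff 1 R') (x : 𝕋³) :
    ⟪twoHalf V R x, FunctionSpaces.Torus.convect (twoHalf V R) (twoHalf V' R') x⟫_ℝ =
      ⟪V (planarProj x), FunctionSpaces.Torus.convect V V' (planarProj x)⟫_ℝ +
        R (planarProj x) * FunctionSpaces.Torus.fderiv R' (planarProj x) (V (planarProj x)) := by
  rw [convect_twoHalf_twoHalf V R hV' hR', inner_twoHalf]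

end TwoHalf

/-! ## Averaging a three-dimensional test field along the third axis -/

section TestAvg

variable {T : ℝ} {ψ : ℝ → 𝕋³ → E³}

/-- The third-axis average of a space–time field on `T³`. [folklore] -/
def axisAvg₃ (ψ : ℝ → 𝕋³ → E³) : ℝ → 𝕋³ → E³ := fun t => axisAvg (Fin.last 2) (ψ t)

/-- The planar part of the planar section of the third-axis average (a field on `T²`). [folklore] -/
def planarTest (ψ : ℝ → 𝕋³ → E³) : ℝ → 𝕋² → E² := fun t y => planarProjE (axisAvg₃ ψ t (planarSect y))

/-- The vertical part of the planar section of the third-axis average (a scalar on `T²`). [folklore] -/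
def verticalTest (ψ : ℝ → 𝕋³ → E³) : ℝ → 𝕋² → ℝ := fun t y => axisAvg₃ ψ t (planarSect y) 2

/-- The averaged field is invariant under the translations along the third axis. [folklore] -/
theorem axisAvg₃_add_single (ψ : ℝ → 𝕋³ → E³) (t : ℝ) (s : UnitAddCircle) (x : 𝕋³) :
    axisAvg₃ ψ t (x + Pi.single (Fin.last 2) s) = axisAvg₃ ψ t x :=
  axisAvg_add_single (Fin.last 2) (ψ t) s x

/-- **The averaged test field is the `2½`-dimensional field of its planar and vertical parts.** [folklore] -/
theorem axisAvg₃_eq_twoHalf (ψ : ℝ → 𝕋³ → E³) (t : ℝ) :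
    axisAvg₃ ψ t = twoHalf (planarTest ψ t) (verticalTest ψ t) :=
  eq_twoHalf_of_forall_add_single (axisAvg₃_add_single ψ t)

/-- The averaged test field is a space–time test field. [folklore] -/
theorem isSpaceTimeTest_axisAvg₃ (hψ : IsSpaceTimeTest T ψ) : IsSpaceTimeTest T (axisAvg₃ ψ) :=
  hψ.axisAvg (Fin.last 2)

/-- The planar part is a space–time test field on `T²`. [folklore] -/
theorem isSpaceTimeTest_planarTest (hψ : IsSpaceTimeTest T ψ) : IsSpaceTimeTest T (planarTest ψ) := by
  obtain ⟨hs, T', hT', h0⟩ := isSpaceTimeTest_axisAvg₃ hψ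
  refine ⟨?_, T', hT', fun t ht => ?_⟩
  · have h : stLift (planarTest ψ) = planarProjE ∘ stLift (fun t => axisAvg₃ ψ t ∘ planarSect) := by
      funext p; rfl
    rw [h]
    exact planarProjE.contDiff.comp (contDiff_stLift_comp_planarSect hs)
  · funext y
    simp [planarTest, h0 t ht]

/-- The vertical part is a space–time test function on `T²`. [folklore] -/
theorem isSpaceTimeTest_verticalTest (hψ : IsSpaceTimeTest T ψ) : IsSpaceTimeTest T (verticalTest ψ) := by
  obtain ⟨hs, T', hT', h0⟩ := isSpaceTimeTest_axisAvg₃ hψ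
  refine ⟨?_, T', hT', fun t ht => ?_⟩
  · have h : stLift (verticalTest ψ) =
        (EuclideanSpace.proj (2 : Fin 3) : E³ →L[ℝ] ℝ) ∘ stLift (fun t => axisAvg₃ ψ t ∘ planarSect) := by
      funext p; rfl
    rw [h]
    exact (EuclideanSpace.proj (2 : Fin 3)).contDiff.comp (contDiff_stLift_comp_planarSect hs)
  · funext y
    simp [verticalTest, h0 t ht]

/-- The planar part of the average of a divergence-free test field is divergence free. [folklore] -/
theorem isDivFreeTest_planarTest (hψ : IsSpaceTimeTest T ψ) (hdiv : IsDivFreeTest ψ) :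
    IsDivFreeTest (planarTest ψ) := by
  intro t y
  have h1 : divergence (axisAvg₃ ψ t) (planarSect y) = 0 :=
    (IsDivFree.axisAvg (hψ.isSmooth_slice t) (hdiv t) (Fin.last 2)) (planarSect y)
  rw [axisAvg₃_eq_twoHalf, divergence_twoHalf, Function.comp_apply, planarProj_planarSect] at h1
  exact h1

/-- **Time derivative of the averaged test field** in terms of its planar and vertical parts:
`∂ₜ ψ̄(t) = (∂ₜΨ(t), ∂ₜΨ₃(t)) ∘ π`. [folklore] -/
theorem timeDeriv_axisAvg₃_eq_twoHalf (hψ : IsSpaceTimeTest T ψ) (t : ℝ) :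
    FunctionSpaces.Torus.timeDeriv (axisAvg₃ ψ) t = twoHalf (FunctionSpaces.Torus.timeDeriv (planarTest ψ) t) (FunctionSpaces.Torus.timeDeriv (verticalTest ψ) t) := by
  have hs : ContDiff ℝ ∞ (stLift (axisAvg₃ ψ)) := (isSpaceTimeTest_axisAvg₃ hψ).1
  -- the time derivative of the averaged field is again invariant along the third axis
  have hinv : ∀ (s : UnitAddCircle) (x : 𝕋³),
      FunctionSpaces.Torus.timeDeriv (axisAvg₃ ψ) t (x + Pi.single (Fin.last 2) s) = FunctionSpaces.Torus.timeDeriv (axisAvg₃ ψ) t x := by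
    intro s x
    simp only [FunctionSpaces.Torus.timeDeriv, axisAvg₃_add_single]
  rw [eq_twoHalf_of_forall_add_single hinv]
  congr 1
  · funext y
    have hd := hasDerivAt_slice_timeDeriv hs t (planarSect y)
    exact ((planarProjE.hasFDerivAt.comp_hasDerivAt t hd).deriv).symm
  · funext y
    have hd := hasDerivAt_slice_timeDeriv hs t (planarSect y)
    exact (((EuclideanSpace.proj (2 : Fin 3) : E³ →L[ℝ] ℝ).hasFDerivAt.comp_hasDerivAt t hd).deriv).symm

end TestAvg

/-! ## Pairings of invariant `L²` fields on `T³` with test data: only axis averages matter -/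

section Pairings

variable {A : 𝕋³ → E³}

/-- **An invariant `L²` field paired with a smooth field only sees its third-axis average.** [folklore] -/
theorem integral_inner_eq_axisAvg_of_isSmooth (hA : MemLp A 2 volume)
    (hAinv : ∀ (s : UnitAddCircle) (x : 𝕋³), A (x + Pi.single (Fin.last 2) s) = A x)
    {B : 𝕋³ → E³} (hB : IsSmooth B) :
    ∫ x, ⟪A x, B x⟫_ℝ = ∫ x, ⟪A x, axisAvg (Fin.last 2) B x⟫_ℝ := by
  obtain ⟨C, hC⟩ := isCompact_univ.exists_bound_of_continuousOn hB.continuous.continuousOn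
  exact integral_inner_eq_integral_inner_axisAvg (Fin.last 2) hAinv hA.1 hB.integrable
    (integrable_inner_shift_of_bound _ (hA.integrable one_le_two) hB.continuous.aestronglyMeasurable
      (fun x => hC x (mem_univ x)))

/-- **An invariant `L²` field paired with an `L²` field only sees its third-axis average.** [folklore] -/
theorem integral_inner_eq_axisAvg_of_memLp (hA : MemLp A 2 volume)
    (hAinv : ∀ (s : UnitAddCircle) (x : 𝕋³), A (x + Pi.single (Fin.last 2) s) = A x)
    {B : 𝕋³ → E³} (hB : MemLp B 2 volume) :
    ∫ x, ⟪A x, B x⟫_ℝ = ∫ x, ⟪A x, axisAvg (Fin.last 2) B x⟫_ℝ :=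
  integral_inner_eq_integral_inner_axisAvg (Fin.last 2) hAinv hA.1 (hB.integrable one_le_two)
    (integrable_inner_shift_of_memLp _ hA hB)

/-- `Aⱼ A ∈ L¹` for `A ∈ L²`. [folklore] -/
theorem integrable_coord_smul (hA : MemLp A 2 volume) (j : Fin 3) :
    Integrable (fun x => A x j • A x) volume := by
  have hm : AEStronglyMeasurable (fun x => A x j • A x) volume :=
    ((EuclideanSpace.proj j).continuous.comp_aestronglyMeasurable hA.1).smul hA.1
  refine (hA.integrable_norm_pow two_ne_zero).mono' hm (ae_of_all _ fun x => ?_)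
  rw [norm_smul, sq]
  exact mul_le_mul_of_nonneg_right (PiLp.norm_apply_le (A x) j) (norm_nonneg _)

/-- `x ↦ Aⱼ(x) ⟪A(x), B(x)⟫` is integrable for `A ∈ L²` and continuous `B`. [folklore] -/
theorem integrable_coord_mul_inner (hA : MemLp A 2 volume) {B : 𝕋³ → E³} (hB : Continuous B) (j : Fin 3) :
    Integrable (fun x => A x j * ⟪A x, B x⟫_ℝ) volume := by
  obtain ⟨C, hC⟩ := isCompact_univ.exists_bound_of_continuousOn hB.continuousOn
  have hm : AEStronglyMeasurable (fun x => A x j * ⟪A x, B x⟫_ℝ) volume :=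
    ((EuclideanSpace.proj j).continuous.comp_aestronglyMeasurable hA.1).mul (hA.1.inner hB.aestronglyMeasurable)
  refine ((integrable_coord_smul hA j).norm.mul_const C).mono' hm (ae_of_all _ fun x => ?_)
  rw [norm_mul, norm_smul]
  calc ‖A x j‖ * ‖⟪A x, B x⟫_ℝ‖ ≤ ‖A x j‖ * (‖A x‖ * ‖B x‖) :=
        mul_le_mul_of_nonneg_left (norm_inner_le_norm _ _) (norm_nonneg _)
    _ ≤ ‖A x j‖ * (‖A x‖ * C) :=
        mul_le_mul_of_nonneg_left (mul_le_mul_of_nonneg_left (hC x (mem_univ x)) (norm_nonneg _)) (norm_nonneg _)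
    _ = ‖A x j‖ * ‖A x‖ * C := by ring

/-- The convective pairing of an `L²` field against a smooth field, expanded and integrated:
`∫ ⟪A, (A·∇)φ⟫ = ∑ⱼ ∫ ⟪Aⱼ A, ∂ⱼφ⟫`. [folklore] -/
theorem integral_inner_convect_eq_sum (hA : MemLp A 2 volume) {φ : 𝕋³ → E³} (hφ : IsSmooth φ) :
    ∫ x, ⟪A x, FunctionSpaces.Torus.convect A φ x⟫_ℝ =
      ∑ j, ∫ x, ⟪A x j • A x, FunctionSpaces.Torus.partialDeriv j φ x⟫_ℝ := by
  have h1 : IsContDiff 1 φ := hφ.isContDiff (by simp)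
  simp_rw [inner_convect_eq_sum h1]
  rw [integral_finsetSum _ fun j _ => integrable_coord_mul_inner hA (hφ.partialDeriv j).continuous j]
  refine Finset.sum_congr rfl fun j _ => integral_congr_ae (ae_of_all _ fun x => ?_)
  show A x j * ⟪A x, FunctionSpaces.Torus.partialDeriv j φ x⟫_ℝ = ⟪A x j • A x, FunctionSpaces.Torus.partialDeriv j φ x⟫_ℝ
  rw [real_inner_smul_left]

/-- **The convective pairing of an invariant `L²` field against a smooth field only sees the
third-axis average of the latter**: `∫ ⟪A, (A·∇)φ⟫ = ∫ ⟪A, (A·∇)(axisAvg e₃ φ)⟫` (termwise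
`integral_inner_eq_axisAvg_of_isSmooth` for the invariant fields `Aⱼ A`, and `∂ⱼ` commutes with the
average). [folklore] -/
theorem integral_inner_convect_eq_axisAvg (hA : MemLp A 2 volume)
    (hAinv : ∀ (s : UnitAddCircle) (x : 𝕋³), A (x + Pi.single (Fin.last 2) s) = A x)
    {φ : 𝕋³ → E³} (hφ : IsSmooth φ) :
    ∫ x, ⟪A x, FunctionSpaces.Torus.convect A φ x⟫_ℝ =
      ∫ x, ⟪A x, FunctionSpaces.Torus.convect A (axisAvg (Fin.last 2) φ) x⟫_ℝ := by
  rw [integral_inner_convect_eq_sum hA hφ, integral_inner_convect_eq_sum hA (hφ.axisAvg _)]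
  refine Finset.sum_congr rfl fun j _ => ?_
  rw [partialDeriv_axisAvg hφ]
  have hinv : ∀ (s : UnitAddCircle) (x : 𝕋³),
      A (x + Pi.single (Fin.last 2) s) j • A (x + Pi.single (Fin.last 2) s) = A x j • A x := by
    intro s x
    rw [hAinv]
  obtain ⟨C, hC⟩ := isCompact_univ.exists_bound_of_continuousOn (hφ.partialDeriv j).continuous.continuousOn
  exact integral_inner_eq_integral_inner_axisAvg (Fin.last 2) hinv
    (((EuclideanSpace.proj j).continuous.comp_aestronglyMeasurable hA.1).smul hA.1)
    (hφ.partialDeriv j).integrable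
    (integrable_inner_shift_of_bound _ (integrable_coord_smul hA j)
      (hφ.partialDeriv j).continuous.aestronglyMeasurable (fun x => hC x (mem_univ x)))

end Pairings

/-! ## Descent of pairings of `2½`-dimensional fields to `T²` -/

section Descent

variable {V V' : 𝕋² → E²} {R R' : 𝕋² → ℝ}

/-- `∫_{T³} ⟪(V,R)∘π, (V',R')∘π⟫ = ∫_{T²} ⟪V,V'⟫ + ∫_{T²} R R'` for integrable planar pairings. [folklore] -/
theorem integral_inner_twoHalf_eq_add (h1 : Integrable (fun y => ⟪V y, V' y⟫_ℝ) volume)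
    (h2 : Integrable (fun y => R y * R' y) volume) :
    ∫ x, ⟪twoHalf V R x, twoHalf V' R' x⟫_ℝ = (∫ y, ⟪V y, V' y⟫_ℝ) + ∫ y, R y * R' y := by
  simp_rw [inner_twoHalf]
  rw [← integral_add h1 h2]
  exact integral_comp_planarProj (b := fun y => ⟪V y, V' y⟫_ℝ + R y * R' y) (h1.add h2).aestronglyMeasurable

/-- `∫_{T³} ⟪(V,R)∘π, ((V,R)∘π·∇)((V',R')∘π)⟫ = ∫_{T²} ⟪V, (V·∇)V'⟫ + ∫_{T²} R ⟪V, ∇R'⟫` for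
integrable planar pairings. [folklore] -/
theorem integral_inner_twoHalf_convect_eq_add (hV' : IsContDiff 1 V') (hR' : IsContDiff 1 R')
    (h1 : Integrable (fun y => ⟪V y, FunctionSpaces.Torus.convect V V' y⟫_ℝ) volume)
    (h2 : Integrable (fun y => R y * ⟪V y, gradient R' y⟫_ℝ) volume) :
    ∫ x, ⟪twoHalf V R x, FunctionSpaces.Torus.convect (twoHalf V R) (twoHalf V' R') x⟫_ℝ =
      (∫ y, ⟪V y, FunctionSpaces.Torus.convect V V' y⟫_ℝ) + ∫ y, R y * ⟪V y, gradient R' y⟫_ℝ := by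
  have hpt : ∀ x : 𝕋³, ⟪twoHalf V R x, FunctionSpaces.Torus.convect (twoHalf V R) (twoHalf V' R') x⟫_ℝ =
      ⟪V (planarProj x), FunctionSpaces.Torus.convect V V' (planarProj x)⟫_ℝ +
        R (planarProj x) * ⟪V (planarProj x), gradient R' (planarProj x)⟫_ℝ := fun x => by
    rw [inner_twoHalf_convect V R hV' hR', ← FunctionSpaces.Torus.inner_gradient_left,
      real_inner_comm (V (planarProj x)) (gradient R' (planarProj x))]
  simp_rw [hpt]
  rw [← integral_add h1 h2]
  exact integral_comp_planarProj
    (b := fun y => ⟪V y, FunctionSpaces.Torus.convect V V' y⟫_ℝ + R y * ⟪V y, gradient R' y⟫_ℝ)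
    (h1.add h2).aestronglyMeasurable

end Descent

/-! ## Scalar pairings as inner products in `ℝ` -/

section Scalar

/-- `a b = ⟪a, b⟫_ℝ` (to feed scalar pairings to the inner-product bookkeeping lemmas). [folklore] -/
theorem mul_eq_real_inner (a b : ℝ) : a * b = ⟪a, b⟫_ℝ := by
  simp [mul_comm]

end Scalar

/-! ## The `2½`-dimensional lift of a planar weak Euler solution and a transported scalar -/

section Lift

variable {T : ℝ} {u : ℝ → 𝕋² → E²} {v₀ : 𝕋² → E²} {w : ℝ → 𝕋² → ℝ} {w₀ : 𝕋² → ℝ}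

/-- `∫ ‖f‖ ≤ 1 + ∫ ‖f‖²` on a probability space. [folklore] -/
theorem integral_norm_le_one_add {α : Type*} [MeasurableSpace α] {μ : Measure α} [IsProbabilityMeasure μ]
    {E : Type*} [NormedAddCommGroup E] {f : α → E} (hf : MemLp f 2 μ) :
    ∫ x, ‖f x‖ ∂μ ≤ 1 + ∫ x, ‖f x‖ ^ 2 ∂μ := by
  have h2 : Integrable (fun x => ‖f x‖ ^ 2) μ := hf.integrable_norm_pow two_ne_zero
  have h1 : Integrable (fun x => ‖f x‖) μ := (hf.integrable one_le_two).norm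
  calc ∫ x, ‖f x‖ ∂μ ≤ ∫ x, (1 + ‖f x‖ ^ 2) ∂μ := by
        refine integral_mono h1 ((integrable_const 1).add h2) fun y => ?_
        nlinarith [sq_nonneg (‖f y‖ - 1), norm_nonneg (f y)]
    _ = 1 + ∫ x, ‖f x‖ ^ 2 ∂μ := by
        rw [integral_add (integrable_const 1) h2, integral_const]
        simp

/-- `⟪f, g⟫ ∈ L¹` for `f, g ∈ L²`. [folklore] -/
theorem integrable_inner_of_memLp_two {α : Type*} [MeasurableSpace α] {μ : Measure α}
    {G : Type*} [NormedAddCommGroup G] [InnerProductSpace ℝ G] {f g : α → G}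
    (hf : MemLp f 2 μ) (hg : MemLp g 2 μ) : Integrable (fun x => ⟪f x, g x⟫_ℝ) μ := by
  have hprod : Integrable (fun x => ‖f x‖ * ‖g x‖) μ := hf.norm.integrable_mul hg.norm
  exact hprod.mono' (hf.1.inner hg.1) (ae_of_all _ fun x => norm_inner_le_norm (f x) (g x))

/-- **Energy of the lift**: `∫⁻ ‖(u(t), w(t))∘π‖ₑ² ≤ ∫⁻ ‖(v₀, w₀)∘π‖ₑ²` from the two planar energy
inequalities. [folklore] -/
theorem lintegral_enorm_sq_twoHalf_le {a : 𝕋² → E²} {r : 𝕋² → ℝ} (ha : AEStronglyMeasurable a volume)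
    (hr : AEStronglyMeasurable r volume) (hv₀ : AEStronglyMeasurable v₀ volume) (hw₀ : AEStronglyMeasurable w₀ volume)
    (haE : ∫⁻ y, ‖a y‖ₑ ^ 2 ≤ ∫⁻ y, ‖v₀ y‖ₑ ^ 2) (hrE : ∫⁻ y, ‖r y‖ₑ ^ 2 ≤ ∫⁻ y, ‖w₀ y‖ₑ ^ 2) :
    ∫⁻ x, ‖twoHalf a r x‖ₑ ^ 2 ≤ ∫⁻ x, ‖twoHalf v₀ w₀ x‖ₑ ^ 2 := by
  rw [lintegral_enorm_sq_twoHalf ha hr, lintegral_enorm_sq_twoHalf hv₀ hw₀]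
  exact add_le_add haE hrE

/-- **Weak incompressibility of the lift**: if `a ∈ L²(T²)` is weakly divergence free and
`r ∈ L²(T²)`, then `(a, r)∘π` is weakly divergence free on `T³` (pair `∇θ` with the invariant
field: only the third-axis average `θ̄` of `θ` matters, `∇θ̄ = (∇Θ, 0)∘π` for the planar section
`Θ` of `θ̄`, and `∫ ⟪a, ∇Θ⟫ = 0`). [folklore] -/
theorem isWeaklyDivFree_twoHalf {a : 𝕋² → E²} {r : 𝕋² → ℝ} (ha : MemLp a 2 volume) (hr : MemLp r 2 volume)
    (hdiv : FunctionSpaces.Torus.IsWeaklyDivFree a) : FunctionSpaces.Torus.IsWeaklyDivFree (twoHalf a r) := by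
  intro θ hθ
  have hA : MemLp (twoHalf a r) 2 volume := memLp_twoHalf one_le_two ha hr
  rw [integral_inner_eq_axisAvg_of_isSmooth hA (twoHalf_add_single a r) hθ.gradient,
    ← gradient_axisAvg hθ (Fin.last 2)]
  -- the averaged scalar is the planar lift of its planar section
  set Θ : 𝕋² → ℝ := axisAvg (Fin.last 2) θ ∘ planarSect with hΘ_def
  have hΘs : IsSmooth Θ := (hθ.axisAvg (Fin.last 2)).comp_planarSect
  have heq : axisAvg (Fin.last 2) θ = Θ ∘ planarProj :=
    eq_comp_planarSect_comp_planarProj (axisAvg_add_single (Fin.last 2) θ)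
  rw [heq, gradient_comp_planarProj (hΘs.isContDiff (by simp)),
    integral_inner_twoHalf_eq_add (integrable_inner_of_memLp_two ha (hΘs.gradient.memLp 2))
      (by simp)]
  simp [hdiv Θ hΘs]

/-- **Weak continuity of the lift**: if `t ↦ u(t)` and `t ↦ w(t)` are weakly continuous into
`L²(T²)` on `[0,T]` (with `L²` slices), then `t ↦ (u(t), w(t))∘π` is weakly continuous into
`L²(T³)` on `[0,T]` (pair a test field `W ∈ L²(T³)` with the invariant slice: only the third-axis
average of `W` matters, and it is the lift of an `L²(T²)` field). [folklore] -/
theorem continuousOn_integral_inner_twoHalf (hu2 : ∀ t ∈ Icc 0 T, MemLp (u t) 2 volume)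
    (hw2 : ∀ t ∈ Icc 0 T, MemLp (w t) 2 volume)
    (huc : ∀ g : 𝕋² → E², MemLp g 2 volume → ContinuousOn (fun t => ∫ y, ⟪u t y, g y⟫_ℝ) (Icc 0 T))
    (hwc : ∀ g : 𝕋² → ℝ, MemLp g 2 volume → ContinuousOn (fun t => ∫ y, w t y * g y) (Icc 0 T))
    {W : 𝕋³ → E³} (hW : MemLp W 2 volume) :
    ContinuousOn (fun t => ∫ x, ⟪twoHalf (u t) (w t) x, W x⟫_ℝ) (Icc 0 T) := by
  set g : 𝕋² → E³ := axisAvg (Fin.last 2) W ∘ planarSect with hg_def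
  have hg : MemLp g 2 volume := memLp_axisAvg_comp_planarSect hW
  have hg₁ : MemLp (fun y => planarProjE (g y)) 2 volume := planarProjE.comp_memLp' hg
  have hg₂ : MemLp (fun y => g y 2) 2 volume := (EuclideanSpace.proj (2 : Fin 3) : E³ →L[ℝ] ℝ).comp_memLp' hg
  have heq : axisAvg (Fin.last 2) W = twoHalf (fun y => planarProjE (g y)) (fun y => g y 2) :=
    eq_twoHalf_of_forall_add_single (axisAvg_add_single (Fin.last 2) W)
  have hcont : ContinuousOn (fun t => (∫ y, ⟪u t y, planarProjE (g y)⟫_ℝ) + ∫ y, w t y * g y 2) (Icc 0 T) :=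
    (huc _ hg₁).add (hwc _ hg₂)
  refine hcont.congr fun t ht => ?_
  have hA : MemLp (twoHalf (u t) (w t)) 2 volume := memLp_twoHalf one_le_two (hu2 t ht) (hw2 t ht)
  show ∫ x, ⟪twoHalf (u t) (w t) x, W x⟫_ℝ = (∫ y, ⟪u t y, planarProjE (g y)⟫_ℝ) + ∫ y, w t y * g y 2
  rw [integral_inner_eq_axisAvg_of_memLp hA (twoHalf_add_single _ _) hW, heq,
    integral_inner_twoHalf_eq_add (integrable_inner_of_memLp_two (hu2 t ht) hg₁) ((hw2 t ht).integrable_mul hg₂)]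

/-- **Initial datum of the lift**: `(u(0), w(0))∘π = (v₀, w₀)∘π` a.e. on `T³` if `u(0) = v₀` a.e. on
`T²` and `w(0) = w₀`. [folklore] -/
theorem twoHalf_zero_ae_eq (hu0 : u 0 =ᵐ[volume] v₀) (hw0 : w 0 = w₀) :
    twoHalf (u 0) (w 0) =ᵐ[volume] twoHalf v₀ w₀ := by
  have h := measurePreserving_planarProj.quasiMeasurePreserving.ae_eq_comp hu0
  filter_upwards [h] with x hx
  simp only [Function.comp_apply] at hx
  rw [twoHalf, twoHalf, hw0, hx]

end Lift

/-! ## The weak Euler identity of the lift -/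

section WeakIdentity

variable {T : ℝ} {u : ℝ → 𝕋² → E²} {v₀ : 𝕋² → E²} {w : ℝ → 𝕋² → ℝ} {w₀ : 𝕋² → ℝ}

/-- Slice integrability of `y ↦ w(t,y) ⟪u(t,y), ∇φ(t,y)⟫` for `L²` slices and a scalar test
function. [folklore] -/
theorem integrable_mul_inner_gradient_slice {φ : ℝ → 𝕋² → ℝ} (hφ : IsSpaceTimeTest T φ) {t : ℝ}
    (hu : MemLp (u t) 2 volume) (hw : MemLp (w t) 2 volume) :
    Integrable (fun y => w t y * ⟪u t y, gradient (φ t) y⟫_ℝ) volume := by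
  obtain ⟨M, hM⟩ := isCompact_univ.exists_bound_of_continuousOn
    (hφ.isSmooth_slice t).gradient.continuous.continuousOn
  have hm : AEStronglyMeasurable (fun y => w t y * ⟪u t y, gradient (φ t) y⟫_ℝ) volume :=
    hw.1.mul (hu.1.inner (hφ.isSmooth_slice t).gradient.continuous.aestronglyMeasurable)
  have hprod : Integrable (fun y => ‖w t y‖ * ‖u t y‖) volume := hw.norm.integrable_mul hu.norm
  refine (hprod.mul_const M).mono' hm (ae_of_all _ fun y => ?_)
  rw [norm_mul]
  calc ‖w t y‖ * ‖⟪u t y, gradient (φ t) y⟫_ℝ‖ ≤ ‖w t y‖ * (‖u t y‖ * ‖gradient (φ t) y‖) :=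
        mul_le_mul_of_nonneg_left (norm_inner_le_norm _ _) (norm_nonneg _)
    _ ≤ ‖w t y‖ * (‖u t y‖ * M) :=
        mul_le_mul_of_nonneg_left (mul_le_mul_of_nonneg_left (hM y (mem_univ y)) (norm_nonneg _)) (norm_nonneg _)
    _ = ‖w t y‖ * ‖u t y‖ * M := by ring

/-- Time integrability of `t ↦ ∫ w(t) ⟪u(t), ∇φ(t)⟫` on `(0,T)` under uniform `L²` bounds. [folklore] -/
theorem integrableOn_integral_mul_inner_gradient {φ : ℝ → 𝕋² → ℝ} (hφ : IsSpaceTimeTest T φ)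
    (hum : AEStronglyMeasurable (uncurry u) ((volume.restrict (Ioo 0 T)).prod (volume : Measure 𝕋²)))
    (hwm : AEStronglyMeasurable (uncurry w) ((volume.restrict (Ioo 0 T)).prod (volume : Measure 𝕋²)))
    (hu2 : ∀ t ∈ Ioo 0 T, MemLp (u t) 2 volume) (hw2 : ∀ t ∈ Ioo 0 T, MemLp (w t) 2 volume)
    {Cu Cw : ℝ} (hCu : ∀ t ∈ Ioo 0 T, ∫ y, ‖u t y‖ ^ 2 ≤ Cu) (hCw : ∀ t ∈ Ioo 0 T, ∫ y, ‖w t y‖ ^ 2 ≤ Cw) :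
    IntegrableOn (fun t => ∫ y, w t y * ⟪u t y, gradient (φ t) y⟫_ℝ) (Ioo 0 T) volume := by
  obtain ⟨M, hM⟩ := exists_bound_of_continuous_uncurry hφ.continuous_uncurry_gradient 0 T
  have h2 : AEStronglyMeasurable (fun p : ℝ × 𝕋² => w p.1 p.2 * ⟪u p.1 p.2, gradient (φ p.1) p.2⟫_ℝ)
      ((volume.restrict (Ioo 0 T)).prod (volume : Measure 𝕋²)) :=
    hwm.mul (hum.inner hφ.continuous_uncurry_gradient.aestronglyMeasurable)
  have hm : AEStronglyMeasurable (fun t => ∫ y, w t y * ⟪u t y, gradient (φ t) y⟫_ℝ)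
      (volume.restrict (Ioo 0 T)) := h2.integral_prod_right'
  refine IntegrableOn.of_bound measure_Ioo_lt_top hm (|M| * (Cw + Cu)) ?_
  rw [ae_restrict_iff' measurableSet_Ioo]
  refine ae_of_all _ fun t ht => ?_
  have hw2i : Integrable (fun y => ‖w t y‖ ^ 2) volume := (hw2 t ht).integrable_norm_pow two_ne_zero
  have hu2i : Integrable (fun y => ‖u t y‖ ^ 2) volume := (hu2 t ht).integrable_norm_pow two_ne_zero
  have hprod : Integrable (fun y => ‖w t y‖ * ‖u t y‖) volume := (hw2 t ht).norm.integrable_mul (hu2 t ht).norm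
  calc ‖∫ y, w t y * ⟪u t y, gradient (φ t) y⟫_ℝ‖
      ≤ ∫ y, ‖w t y * ⟪u t y, gradient (φ t) y⟫_ℝ‖ := norm_integral_le_integral_norm _
    _ ≤ ∫ y, |M| * (‖w t y‖ * ‖u t y‖) := by
        refine integral_mono_of_nonneg (ae_of_all _ fun y => norm_nonneg _) (hprod.const_mul |M|)
          (ae_of_all _ fun y => ?_)
        show ‖w t y * ⟪u t y, gradient (φ t) y⟫_ℝ‖ ≤ |M| * (‖w t y‖ * ‖u t y‖)
        rw [norm_mul]
        calc ‖w t y‖ * ‖⟪u t y, gradient (φ t) y⟫_ℝ‖ ≤ ‖w t y‖ * (‖u t y‖ * ‖gradient (φ t) y‖) :=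
              mul_le_mul_of_nonneg_left (norm_inner_le_norm _ _) (norm_nonneg _)
          _ ≤ ‖w t y‖ * (‖u t y‖ * |M|) :=
              mul_le_mul_of_nonneg_left (mul_le_mul_of_nonneg_left
                ((hM t (Ioo_subset_Icc_self ht) y).trans (le_abs_self M)) (norm_nonneg _)) (norm_nonneg _)
          _ = |M| * (‖w t y‖ * ‖u t y‖) := by ring
    _ = |M| * ∫ y, ‖w t y‖ * ‖u t y‖ := integral_const_mul _ _
    _ ≤ |M| * (Cw + Cu) := by
        refine mul_le_mul_of_nonneg_left ?_ (abs_nonneg M)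
        calc ∫ y, ‖w t y‖ * ‖u t y‖ ≤ ∫ y, (‖w t y‖ ^ 2 + ‖u t y‖ ^ 2) := by
              refine integral_mono hprod (hw2i.add hu2i) fun y => ?_
              nlinarith [sq_nonneg (‖w t y‖ - ‖u t y‖), norm_nonneg (w t y), norm_nonneg (u t y)]
          _ = (∫ y, ‖w t y‖ ^ 2) + ∫ y, ‖u t y‖ ^ 2 := integral_add hw2i hu2i
          _ ≤ Cw + Cu := add_le_add (hCw t ht) (hCu t ht)

/-- Slice integrability of `y ↦ w(t,y) φ'(t,y)` for an `L²` slice and a jointly continuous `φ'`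
bounded at time `t`. [folklore] -/
theorem integrable_mul_slice {φ' : ℝ → 𝕋² → ℝ} (hφ' : Continuous (uncurry φ')) {t : ℝ} {M : ℝ}
    (hM : ∀ y, ‖φ' t y‖ ≤ M) (hw : MemLp (w t) 2 volume) :
    Integrable (fun y => w t y * φ' t y) volume := by
  have h := integrable_inner_slice (U := w) (Φ := φ') (hw.integrable one_le_two) hφ' hM
  have heq : (fun y => w t y * φ' t y) = fun y => ⟪w t y, φ' t y⟫_ℝ := funext fun y => mul_eq_real_inner _ _
  rw [heq]
  exact h

/-- Time integrability of `t ↦ ∫ w(t) φ'(t)` on `(0,T)` for jointly continuous bounded `φ'` under a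
uniform `L²` bound. [folklore] -/
theorem integrableOn_integral_mul {φ' : ℝ → 𝕋² → ℝ} (hφ' : Continuous (uncurry φ'))
    (hwm : AEStronglyMeasurable (uncurry w) ((volume.restrict (Ioo 0 T)).prod (volume : Measure 𝕋²)))
    (hw2 : ∀ t ∈ Ioo 0 T, MemLp (w t) 2 volume) {Cw : ℝ} (hCw : ∀ t ∈ Ioo 0 T, ∫ y, ‖w t y‖ ^ 2 ≤ Cw) :
    IntegrableOn (fun t => ∫ y, w t y * φ' t y) (Ioo 0 T) volume := by
  obtain ⟨M, hM⟩ := exists_bound_of_continuous_uncurry hφ' 0 T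
  have h := integrableOn_integral_inner (U := w) (Φ := φ') hwm (fun t ht => (hw2 t ht).integrable one_le_two)
    (C := 1 + Cw) (fun t ht => (integral_norm_le_one_add (hw2 t ht)).trans (by linarith [hCw t ht]))
    hφ' (M := |M|) (fun t ht y => (hM t (Ioo_subset_Icc_self ht) y).trans (le_abs_self M)) (abs_nonneg M)
  have heq : (fun t => ∫ y, w t y * φ' t y) = fun t => ∫ y, ⟪w t y, φ' t y⟫_ℝ := by
    funext t
    exact integral_congr_ae (ae_of_all _ fun y => mul_eq_real_inner _ _)
  rw [heq]
  exact h

/-- **The weak Euler identity of the `2½`-dimensional lift** (the computation in the proof of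
Bardos–Titi–Wiedemann 2012, Cor. 2: "the triple `(u₁, u₂, w)` will be a weak solution of the 3D
Euler equations (with zero pressure and initial data `v₀`) if `w` is a weak solution of the 2D
transport equation `∂ₜw + u·∇w = 0`, `w(t=0) = v₃`"). For a planar weak Euler solution `u` with datum
`v₀` and a weak solution `w` of the transport equation driven by `u` with datum `w₀`, both with
`L²` slices of uniformly bounded norm on `[0,T]`, the lift `(u, w)∘π` satisfies the weak Euler
identity on `T³ × [0,T)` with datum `(v₀, w₀)∘π` against every divergence-free space–time test
field `ψ`: pairing with the `x₃`-independent lift only sees the `x₃`-average `ψ̄ = (Ψ, Ψ₃)∘π` of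
`ψ`, and the identity splits into the planar Euler identity tested with `Ψ` plus the transport
identity tested with `Ψ₃`. [cite: BardosTitiWiedemann2012, Cor. 2, proof] -/
theorem weakIdentity_twoHalf (hv₀ : MemLp v₀ 2 volume) (hw₀ : MemLp w₀ 2 volume)
    (hsol : IsWeakNSSolutionWithDataOn T 0 v₀ u)
    (hu2 : ∀ t ∈ Icc 0 T, MemLp (u t) 2 volume)
    (huE : ∀ t ∈ Icc 0 T, ∫⁻ y, ‖u t y‖ₑ ^ 2 ≤ ∫⁻ y, ‖v₀ y‖ₑ ^ 2)
    (hwsol : IsWeakScalarTransportOn T 0 u w₀ w)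
    (hw2 : ∀ t ∈ Icc 0 T, MemLp (w t) 2 volume)
    (hwE : ∀ t ∈ Icc 0 T, ∫⁻ y, ‖w t y‖ₑ ^ 2 ≤ ∫⁻ y, ‖w₀ y‖ₑ ^ 2)
    {ψ : ℝ → 𝕋³ → E³} (hψ : IsSpaceTimeTest T ψ) (hdiv : IsDivFreeTest ψ) :
    (∫ t in Ioo 0 T, ∫ x, (⟪twoHalf (u t) (w t) x, FunctionSpaces.Torus.timeDeriv ψ t x⟫_ℝ +
        ⟪twoHalf (u t) (w t) x, FunctionSpaces.Torus.convect (twoHalf (u t) (w t)) (ψ t) x⟫_ℝ +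
        (0 : ℝ) * ⟪twoHalf (u t) (w t) x, laplacian (ψ t) x⟫_ℝ)) +
      ∫ x, ⟪twoHalf v₀ w₀ x, ψ 0 x⟫_ℝ = 0 := by
  have hΨ : IsSpaceTimeTest T (planarTest ψ) := isSpaceTimeTest_planarTest hψ
  have hΨ₃ : IsSpaceTimeTest T (verticalTest ψ) := isSpaceTimeTest_verticalTest hψ
  have hΨdiv : IsDivFreeTest (planarTest ψ) := isDivFreeTest_planarTest hψ hdiv
  have hIo : ∀ {t : ℝ}, t ∈ Ioo 0 T → t ∈ Icc 0 T := fun ht => Ioo_subset_Icc_self ht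
  -- measurability
  have hum : AEStronglyMeasurable (uncurry u) ((volume.restrict (Ioo 0 T)).prod (volume : Measure 𝕋²)) :=
    aestronglyMeasurable_uncurry_of_stLift_prod hsol.1
  have hwm : AEStronglyMeasurable (uncurry w) ((volume.restrict (Ioo 0 T)).prod (volume : Measure 𝕋²)) :=
    hwsol.aestronglyMeasurable_uncurry
  have hVm : AEStronglyMeasurable (uncurry fun t => twoHalf (u t) (w t))
      ((volume.restrict (Ioo 0 T)).prod (volume : Measure 𝕋³)) :=
    aestronglyMeasurable_uncurry_twoHalf hum hwm
  -- `L²` slices and uniform bounds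
  have hV2 : ∀ t ∈ Icc 0 T, MemLp (twoHalf (u t) (w t)) 2 volume := fun t ht =>
    memLp_twoHalf one_le_two (hu2 t ht) (hw2 t ht)
  have hV₀ : MemLp (twoHalf v₀ w₀) 2 volume := memLp_twoHalf one_le_two hv₀ hw₀
  have hVE : ∀ t ∈ Icc 0 T, ∫⁻ x, ‖twoHalf (u t) (w t) x‖ₑ ^ 2 ≤ ∫⁻ x, ‖twoHalf v₀ w₀ x‖ₑ ^ 2 :=
    fun t ht => lintegral_enorm_sq_twoHalf_le (hu2 t ht).1 (hw2 t ht).1 hv₀.1 hw₀.1 (huE t ht) (hwE t ht)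
  have hCu : ∀ t ∈ Ioo 0 T, ∫ y, ‖u t y‖ ^ 2 ≤ (∫⁻ y, ‖v₀ y‖ₑ ^ 2).toReal := fun t ht =>
    integral_norm_sq_le_toReal (hu2 t (hIo ht)) hv₀ (huE t (hIo ht))
  have hCw : ∀ t ∈ Ioo 0 T, ∫ y, ‖w t y‖ ^ 2 ≤ (∫⁻ y, ‖w₀ y‖ₑ ^ 2).toReal := fun t ht =>
    integral_norm_sq_le_toReal (hw2 t (hIo ht)) hw₀ (hwE t (hIo ht))
  have hCV : ∀ t ∈ Ioo 0 T, ∫ x, ‖twoHalf (u t) (w t) x‖ ^ 2 ≤ (∫⁻ x, ‖twoHalf v₀ w₀ x‖ₑ ^ 2).toReal :=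
    fun t ht => integral_norm_sq_le_toReal (hV2 t (hIo ht)) hV₀ (hVE t (hIo ht))
  have hu2' : ∀ t ∈ Ioo 0 T, MemLp (u t) 2 volume := fun t ht => hu2 t (hIo ht)
  have hw2' : ∀ t ∈ Ioo 0 T, MemLp (w t) 2 volume := fun t ht => hw2 t (hIo ht)
  -- bounds for the planar test data
  obtain ⟨M₁, hM₁⟩ := exists_bound_of_continuous_uncurry hΨ₃.timeDeriv.continuous_uncurry 0 T
  -- Step 1: split the three-dimensional integrand
  rw [setIntegral_weakIntegrand_eq_add hVm (fun t ht => hV2 t (hIo ht)) hCV hψ]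
  -- Step 2: the time-derivative term
  have hA : ∀ t ∈ Ioo 0 T,
      ∫ x, ⟪twoHalf (u t) (w t) x, FunctionSpaces.Torus.timeDeriv ψ t x⟫_ℝ =
        (∫ y, ⟪u t y, FunctionSpaces.Torus.timeDeriv (planarTest ψ) t y⟫_ℝ) +
          ∫ y, w t y * FunctionSpaces.Torus.timeDeriv (verticalTest ψ) t y := by
    intro t ht
    have h1 := integral_inner_eq_axisAvg_of_isSmooth (hV2 t (hIo ht)) (twoHalf_add_single (u t) (w t))
      (hψ.timeDeriv.isSmooth_slice t)
    have h2 : axisAvg (Fin.last 2) (FunctionSpaces.Torus.timeDeriv ψ t) = FunctionSpaces.Torus.timeDeriv (axisAvg₃ ψ) t := by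
      funext x
      exact (timeDeriv_axisAvg hψ.1 (Fin.last 2) t x).symm
    rw [h1, h2, timeDeriv_axisAvg₃_eq_twoHalf hψ t,
      integral_inner_twoHalf_eq_add (integrable_inner_timeDeriv_slice hΨ (hu2 t (hIo ht)))
        (integrable_mul_slice hΨ₃.timeDeriv.continuous_uncurry (hM₁ t (hIo ht)) (hw2 t (hIo ht)))]
  have hJ₁ := integrableOn_integral_inner_timeDeriv hum hu2' hCu hΨ
  have hK₁ := integrableOn_integral_mul hΨ₃.timeDeriv.continuous_uncurry hwm hw2' hCw
  have hAint : ∫ t in Ioo 0 T, ∫ x, ⟪twoHalf (u t) (w t) x, FunctionSpaces.Torus.timeDeriv ψ t x⟫_ℝ =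
      (∫ t in Ioo 0 T, ∫ y, ⟪u t y, FunctionSpaces.Torus.timeDeriv (planarTest ψ) t y⟫_ℝ) +
        ∫ t in Ioo 0 T, ∫ y, w t y * FunctionSpaces.Torus.timeDeriv (verticalTest ψ) t y := by
    rw [setIntegral_congr_fun measurableSet_Ioo hA, integral_add hJ₁ hK₁]
  -- Step 3: the convective term
  have hB : ∀ t ∈ Ioo 0 T,
      ∫ x, ⟪twoHalf (u t) (w t) x, FunctionSpaces.Torus.convect (twoHalf (u t) (w t)) (ψ t) x⟫_ℝ =
        (∫ y, ⟪u t y, FunctionSpaces.Torus.convect (u t) (planarTest ψ t) y⟫_ℝ) +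
          ∫ y, w t y * ⟪u t y, gradient (verticalTest ψ t) y⟫_ℝ := by
    intro t ht
    rw [integral_inner_convect_eq_axisAvg (hV2 t (hIo ht)) (twoHalf_add_single (u t) (w t)) (hψ.isSmooth_slice t),
      show axisAvg (Fin.last 2) (ψ t) = axisAvg₃ ψ t from rfl, axisAvg₃_eq_twoHalf ψ t,
      integral_inner_twoHalf_convect_eq_add ((hΨ.isSmooth_slice t).isContDiff (by simp))
        ((hΨ₃.isSmooth_slice t).isContDiff (by simp)) (integrable_inner_convect_slice hΨ (hu2 t (hIo ht)))
        (integrable_mul_inner_gradient_slice hΨ₃ (hu2 t (hIo ht)) (hw2 t (hIo ht)))]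
  have hJ₂ := integrableOn_integral_inner_convect hum hu2' hCu hΨ
  have hK₂ := integrableOn_integral_mul_inner_gradient hΨ₃ hum hwm hu2' hw2' hCu hCw
  have hBint : ∫ t in Ioo 0 T, ∫ x, ⟪twoHalf (u t) (w t) x,
      FunctionSpaces.Torus.convect (twoHalf (u t) (w t)) (ψ t) x⟫_ℝ =
      (∫ t in Ioo 0 T, ∫ y, ⟪u t y, FunctionSpaces.Torus.convect (u t) (planarTest ψ t) y⟫_ℝ) +
        ∫ t in Ioo 0 T, ∫ y, w t y * ⟪u t y, gradient (verticalTest ψ t) y⟫_ℝ := by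
    rw [setIntegral_congr_fun measurableSet_Ioo hB, integral_add hJ₂ hK₂]
  -- Step 4: the initial datum term
  have hD : ∫ x, ⟪twoHalf v₀ w₀ x, ψ 0 x⟫_ℝ =
      (∫ y, ⟪v₀ y, planarTest ψ 0 y⟫_ℝ) + ∫ y, w₀ y * verticalTest ψ 0 y := by
    rw [integral_inner_eq_axisAvg_of_isSmooth hV₀ (twoHalf_add_single v₀ w₀) (hψ.isSmooth_slice 0),
      show axisAvg (Fin.last 2) (ψ 0) = axisAvg₃ ψ 0 from rfl, axisAvg₃_eq_twoHalf ψ 0,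
      integral_inner_twoHalf_eq_add (integrable_inner_of_memLp_two hv₀ ((hΨ.isSmooth_slice 0).memLp 2))
        (hw₀.integrable_mul ((hΨ₃.isSmooth_slice 0).memLp 2))]
  -- Step 5: the planar Euler identity, split
  have hE := hsol.2.2.2 (planarTest ψ) hΨ hΨdiv
  rw [setIntegral_weakIntegrand_eq_add hum hu2' hCu hΨ] at hE
  -- Step 6: the transport identity, split
  have hWt := hwsol.weak_eq (verticalTest ψ) hΨ₃
  have hWsplit : (∫ t in Ioo 0 T, ∫ y, w t y * (FunctionSpaces.Torus.timeDeriv (verticalTest ψ) t y +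
      ⟪u t y, gradient (verticalTest ψ t) y⟫_ℝ + 0 * laplacian (verticalTest ψ t) y)) =
      (∫ t in Ioo 0 T, ∫ y, w t y * FunctionSpaces.Torus.timeDeriv (verticalTest ψ) t y) +
        ∫ t in Ioo 0 T, ∫ y, w t y * ⟪u t y, gradient (verticalTest ψ t) y⟫_ℝ := by
    rw [← integral_add hK₁ hK₂]
    refine setIntegral_congr_fun measurableSet_Ioo fun t ht => ?_
    rw [← integral_add (integrable_mul_slice hΨ₃.timeDeriv.continuous_uncurry (hM₁ t (hIo ht)) (hw2 t (hIo ht)))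
      (integrable_mul_inner_gradient_slice hΨ₃ (hu2 t (hIo ht)) (hw2 t (hIo ht)))]
    refine integral_congr_ae (ae_of_all _ fun y => ?_)
    ring
  rw [hWsplit] at hWt
  -- Step 7: assemble
  rw [hAint, hBint, hD]
  linarith

end WeakIdentity

/-! ## The lift is an admissible weak Euler solution -/

section Main

variable {T : ℝ} {u : ℝ → 𝕋² → E²} {v₀ : 𝕋² → E²} {w : ℝ → 𝕋² → ℝ} {w₀ : 𝕋² → ℝ}

/-- **The `2½`-dimensional lift of an admissible planar weak Euler solution and a transported
scalar is an admissible weak Euler solution on `T³`** (Bardos–Titi–Wiedemann, C. R. Math. 350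
(2012), proof of Cor. 2). Let `u` be an admissible weak Euler solution on `T² × [0,T]` with datum
`v₀ ∈ L²` (`IsAdmissibleWeakEulerOn`) whose slices `u(t)`, `t ∈ [0,T]`, lie in `L²`; let `w` be a
weak solution on `T² × [0,T)` of the transport equation `∂ₜw + u·∇w = 0` with datum `w₀ ∈ L²`
(accepted `Torus.IsWeakScalarTransportOn T 0 u w₀ w`, DiPerna–Lions) with `L²` slices,
`‖w(t)‖₂ ≤ ‖w₀‖₂` on `[0,T]`, weakly continuous into `L²` on `[0,T]`, and `w(0) = w₀`. Then
`(u(t), w(t)) ∘ π` is an admissible weak Euler solution on `T³ × [0,T]` with datum `(v₀, w₀) ∘ π`: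
the weak identity is `weakIdentity_twoHalf`, weak incompressibility `isWeaklyDivFree_twoHalf`, weak
continuity `continuousOn_integral_inner_twoHalf`, and the energy inequality is the sum of the two
planar ones ("`‖w(·,t)‖ ≤ ‖v₃‖` … Hence our solution `(u₁,u₂,w)` is an admissible weak solution of
the 3D Euler equations"). [cite: BardosTitiWiedemann2012, Cor. 2, proof] -/
theorem isAdmissibleWeakEulerOn_twoHalf (hv₀ : MemLp v₀ 2 volume) (hw₀ : MemLp w₀ 2 volume)
    (hadm : IsAdmissibleWeakEulerOn T v₀ u) (hu2 : ∀ t ∈ Icc 0 T, MemLp (u t) 2 volume)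
    (hwsol : IsWeakScalarTransportOn T 0 u w₀ w) (hw2 : ∀ t ∈ Icc 0 T, MemLp (w t) 2 volume)
    (hwE : ∀ t ∈ Icc 0 T, ∫⁻ y, ‖w t y‖ₑ ^ 2 ≤ ∫⁻ y, ‖w₀ y‖ₑ ^ 2)
    (hwc : ∀ g : 𝕋² → ℝ, MemLp g 2 volume → ContinuousOn (fun t => ∫ y, w t y * g y) (Icc 0 T))
    (hw0 : w 0 = w₀) :
    IsAdmissibleWeakEulerOn T (twoHalf v₀ w₀) (fun t => twoHalf (u t) (w t)) := by
  obtain ⟨hsol, hu0, huc, huE⟩ := hadm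
  have hIo : ∀ {t : ℝ}, t ∈ Ioo 0 T → t ∈ Icc 0 T := fun ht => Ioo_subset_Icc_self ht
  have hum : AEStronglyMeasurable (uncurry u) ((volume.restrict (Ioo 0 T)).prod (volume : Measure 𝕋²)) :=
    aestronglyMeasurable_uncurry_of_stLift_prod hsol.1
  have hwm : AEStronglyMeasurable (uncurry w) ((volume.restrict (Ioo 0 T)).prod (volume : Measure 𝕋²)) :=
    hwsol.aestronglyMeasurable_uncurry
  have hV₀ : MemLp (twoHalf v₀ w₀) 2 volume := memLp_twoHalf one_le_two hv₀ hw₀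
  have hVE : ∀ t ∈ Icc 0 T, ∫⁻ x, ‖twoHalf (u t) (w t) x‖ₑ ^ 2 ≤ ∫⁻ x, ‖twoHalf v₀ w₀ x‖ₑ ^ 2 :=
    fun t ht => lintegral_enorm_sq_twoHalf_le (hu2 t ht).1 (hw2 t ht).1 hv₀.1 hw₀.1 (huE t ht) (hwE t ht)
  refine ⟨⟨?_, ?_, ?_, fun ψ hψ hdivψ => weakIdentity_twoHalf hv₀ hw₀ hsol hu2 huE hwsol hw2 hwE hψ hdivψ⟩,
    twoHalf_zero_ae_eq hu0 hw0, fun W hW => continuousOn_integral_inner_twoHalf hu2 hw2 huc hwc hW, hVE⟩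
  · exact aestronglyMeasurable_stLift_of_uncurry (aestronglyMeasurable_uncurry_twoHalf hum hwm)
  · calc ∫⁻ t in Ioo 0 T, ∫⁻ x, ‖twoHalf (u t) (w t) x‖ₑ ^ 2
        ≤ ∫⁻ _ in Ioo 0 T, ∫⁻ x, ‖twoHalf v₀ w₀ x‖ₑ ^ 2 :=
          setLIntegral_mono' measurableSet_Ioo fun t ht => hVE t (hIo ht)
      _ = (∫⁻ x, ‖twoHalf v₀ w₀ x‖ₑ ^ 2) * volume (Ioo (0 : ℝ) T) := setLIntegral_const _ _
      _ < ⊤ := ENNReal.mul_lt_top (lintegral_enorm_sq_lt_top hV₀) measure_Ioo_lt_top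
  · filter_upwards [hsol.2.2.1, ae_restrict_mem measurableSet_Ioo] with t hdiv ht
    exact isWeaklyDivFree_twoHalf (hu2 t (hIo ht)) (hw2 t (hIo ht)) hdiv

end Main

end Torus

end Literature.Analysis.FluidPDE

end
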